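import Mathlib
import HarnessLib.Audit
import Summits.PneNP.PneNP.Theorems.PstarMenuCriterion
import Summits.PneNP.PneNP.Theorems.PstarHalfFreeGate

/-!
# Exact coincidences: the semantic branch (B) of the exact-menu criterion, and its poison rule (ROUND-24, O1; memo g24 §38)

FRONTIER range-avoidance ladder, rung F-N3, ROUND 24 (cell `pnp-ideate`, prover-2 memo `g24/O1-NOFREEVERTEX-g24.md` §38; typed targets
`PstarCoreBoundTargets.TerminalFive` / `TerminalPeelable` (p646951); restricted-model proof complexity — nothing here bears on `P` versus `NP`).

In the exact-menu model (`PstarMenuCriterion`) branch (A) carries the whole channel menu `G` in its second reader, and foreign gates poison it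
(`PstarHalfFreeGate`).  Branch (B) as stated there (`NoShortCoincidence c G`, combinatorial) does NOT see the menu beyond which chords it dirties,
so an adversary could mass-produce "short coincidences" through dirty chords (a clean chord closing a triangle with two dirty ones).  But the
obstruction the proof actually meets is the EMPTY-CORE COINCIDENCE of `PstarPairCoreNormal.PairCore.normalForm`: a first reader `Σ_{f ∈ F₁} p_f q_f`
(`c + F₁` everywhere even) and a second reader with monomial set EXACTLY `G ∪ F₂`, JOINTLY UNSATISFIABLE OVER ALL ASSIGNMENTS, each member and
monomial individually essential.  This file exposes that obstruction as the node and shows that junk monomials poison it too: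

* `NoCoincidenceExact I J₀ c G` — no exact empty-core coincidence (the raw data of the normal form, rank bounds included);
  `noCoincidenceExact_of_noShortCoincidence` (the combinatorial node implies it);
* **`sliceGenericExact_of_criterionSharp`**: `NoPathSumSubcoreExact ∧ NoCoincidenceExact ⟹ SliceGenericExact`;
* **`false_of_coincidence_junk`** — POISON RULE FOR COINCIDENCES: if some monomial `g = (σ, π)` of the second reader has `π` in no other monomial
  of either reader and `σ` in no monomial of the first reader, the two readers are jointly satisfiable (flip `π`, or `σ` then `π`) — no
  coincidence.  So a committed menu with a gate away from `F₁ ∪ F₂` certifies nothing through branch (B) either;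
* node **`SharpMenuCriterionBound`** (as `MenuCriterionBound` with `NoCoincidenceExact` for `NoShortCoincidence`; weaker obligation:
  `sharpMenuCriterionBound_of_menuCriterionBound`) and **`terminalFive_of_sharpMenuBound : TerminalFiveA → SharpMenuCriterionBound → TerminalFive`**,
  `terminalPeelable_of_sharpMenuBound`.
-/

set_option linter.dupNamespace false -- `Summit.PneNP.PneNP.…`: summit = sub-problem name (D-0017 single-conjunct layout)

open Finset Module Literature.Computability.Complexity
open scoped symmDiff
open Summit.PneNP.PneNP.Theorems.PstarTyped (Typed)
open Summit.PneNP.PneNP.Theorems.PstarSALevel (varSet bdry BoundaryExpanding SimpleOverlap)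
open Summit.PneNP.PneNP.Theorems.PstarXCore (xpair mem_xpair xverts)
open Summit.PneNP.PneNP.Theorems.PstarGapOneAll (gval)
open Summit.PneNP.PneNP.Theorems.PstarGConstraint (gval_update_of_forall_ne)
open Summit.PneNP.PneNP.Theorems.PstarCoreBound (XorClosed)
open Summit.PneNP.PneNP.Theorems.PstarChordRepair (IsChord)
open Summit.PneNP.PneNP.Theorems.PstarCoreBoundTargets (Terminal TerminalFive TerminalFiveA TerminalPeelable nonchords nonchords_subset mem_nonchords
  terminalPeelable_of_terminalFive)
open Summit.PneNP.PneNP.Theorems.PstarSharingBound (sharedSlots)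
open Summit.PneNP.PneNP.Theorems.PstarChordBridgeTools (xpdeg)
open Summit.PneNP.PneNP.Theorems.PstarChordBridgeCentre (exists_maximal_peelable_sup)
open Summit.PneNP.PneNP.Theorems.PstarNorUnitAssembly (xpdeg_singleton_of_mem)
open Summit.PneNP.PneNP.Theorems.PstarChordReadOutside (OutsideGated)
open Summit.PneNP.PneNP.Theorems.PstarChordReadPairCore (PairCore)
open Summit.PneNP.PneNP.Theorems.PstarProductRank (polar IsInducedMatching)
open Summit.PneNP.PneNP.Theorems.PstarQuadRank (rad)
open Summit.PneNP.PneNP.Theorems.PstarPairCoreNormal (PairCore.normalForm)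
open Summit.PneNP.PneNP.Theorems.PstarPairCoreNoChord (no_chord_in_coincidence)
open Summit.PneNP.PneNP.Theorems.PstarCoincidenceMatching (card_chords_le_two_of_rank_lt_six card_inducedMatching_le_two_of_rank_lt_six)
open Summit.PneNP.PneNP.Theorems.PstarCleanChordCount (exists_clean_chords)
open Summit.PneNP.PneNP.Theorems.PstarTerminalPeelableTwelve (exists_centre_of_not_peelable)
open Summit.PneNP.PneNP.Theorems.PstarSliceGenericCriterion (NoShortCoincidence)
open Summit.PneNP.PneNP.Theorems.PstarSliceGenericInternal (internalMenu internalMenu_subset)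
open Summit.PneNP.PneNP.Theorems.PstarNoFreeVertex (Covered covered_of_terminal)
open Summit.PneNP.PneNP.Theorems.PstarHangingForest (Anchored anchored_of_terminal)
open Summit.PneNP.PneNP.Theorems.PstarCleanCut (Crosses CleanCut smallCriterion_of_crossing)
open Summit.PneNP.PneNP.Theorems.PstarCleanCutAssembly (false_of_cleanCut_two SkConnected NoTwoCrossings)
open Summit.PneNP.PneNP.Theorems.PstarSliceGenericExact (SliceGenericExact)
open Summit.PneNP.PneNP.Theorems.PstarTwoCleanExact (MenuGeneric false_of_two_clean_exact)
open Summit.PneNP.PneNP.Theorems.PstarHalfFreeGate (gval_flip_halfFree)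
open Summit.PneNP.PneNP.Theorems.PstarMenuCriterion (NoPathSumSubcoreExact NoSmallPathSumSubcoreExact noSmallPathSumSubcoreExact_of_subset
  noPathSumSubcoreExact_of_small sliceGenericExact_of_no_pairCore channelMenus subset_of_mem_channelMenus)

namespace Summit.PneNP.PneNP.Theorems.PstarCoincidenceExact

variable {n m : ℕ}

/-- **NO EXACT (EMPTY-CORE) COINCIDENCE at the chord `c` for the monomial set `G`.**  There are no `K ⊆ J₀ ∖ c`, folds `F₁, F₂ ⊆ K` covering `K`,
linear part `C₂` (inside the AND variables of the monomials) and targets with: `c + F₁` everywhere even; the readers `Σ_{F₁} p q` and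
`(C₂, G ∪ F₂)` jointly unsatisfiable over ALL assignments; every member of `K` and every monomial of `G` individually essential; and the two
rank bounds of the normal form. -/
def NoCoincidenceExact (I : LocalMap 4 n m) (J₀ : Finset (Fin m)) (c : Fin m) (G : Finset (Fin m)) : Prop :=
  ∀ K ⊆ J₀.erase c, ∀ (F₁ F₂ : Finset (Fin m)) (C₂ : Finset (Fin n)) (β₁ β₂ : Bool),
    F₁ ⊆ K → F₂ ⊆ K → K ⊆ F₁ ∪ F₂ → F₁.Nonempty →
    (∀ v, Even (xpdeg I (insert c F₁) v)) →
    (∀ v ∈ C₂, ∃ g ∈ F₁ ∪ (G ∪ F₂), I.vars g 2 = v ∨ I.vars g 3 = v) →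
    (∀ z : Fin n → Bool, ¬ (gval I ∅ F₁ z = β₁ ∧ gval I C₂ (G ∪ F₂) z = β₂)) →
    (∀ g ∈ K ∪ G, ∃ z : Fin n → Bool, (gval I ∅ F₁ z = β₁ ↔ g ∉ F₁) ∧ (gval I C₂ (G ∪ F₂) z = β₂ ↔ g ∉ G ∪ F₂)) →
    finrank (ZMod 2) (Fin n → ZMod 2) < finrank (ZMod 2) (rad (polar F₁ (fun j => I.vars j 2) (fun j => I.vars j 3))) + 6 →
    finrank (ZMod 2) (Fin n → ZMod 2) < finrank (ZMod 2) (rad (polar (G ∪ F₂) (fun j => I.vars j 2) (fun j => I.vars j 3))) + 6 →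
    False

variable {I : LocalMap 4 n m} {r : ℕ} {y : Fin m → Bool} {J₀ : Finset (Fin m)} {c : Fin m}

/-- **The combinatorial node implies the exact one** (the combinatorics of short coincidences are consequences of the raw data). -/
theorem noCoincidenceExact_of_noShortCoincidence (hI : I.IsPure xorAndPred) (hS : SimpleOverlap I) {G : Finset (Fin m)} (hdisj : Disjoint J₀ G)
    (h : NoShortCoincidence I J₀ c G) : NoCoincidenceExact I J₀ c G := by
  intro K hK F₁ F₂ C₂ β₁ β₂ hF₁ hF₂ _ hF₁ne heven _ hU hflip hrk₁ _
  have hKJ : K ⊆ J₀ := hK.trans (erase_subset c J₀)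
  have hcK : c ∉ K := fun hc => (mem_erase.1 (hK hc)).1 rfl
  have hdisjKG : Disjoint K G := hdisj.mono_left hKJ
  refine h F₁ (hF₁.trans hK) hF₁ne (fun c' hc' hch hO => ?_) heven (card_chords_le_two_of_rank_lt_six I hI hrk₁)
    fun M hM => card_inducedMatching_le_two_of_rank_lt_six I hM hrk₁
  exact no_chord_in_coincidence hI hS hKJ hcK hF₁ hF₂ hdisjKG (Subset.refl G) heven hU hflip hc' hch hO

/-- **THE SHARP EXACT-MENU CRITERION**: no exact path-sum sub-core and no exact coincidence make the chord exactly generic for `G`. -/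
theorem sliceGenericExact_of_criterionSharp (hI : I.IsPure xorAndPred) (hT : Typed I) (hS : SimpleOverlap I) (hB : BoundaryExpanding r I)
    {G : Finset (Fin m)} (hcJ : c ∈ J₀) (hdisj : Disjoint J₀ G) (hr : (J₀ ∪ G).card ≤ r)
    (hA : NoPathSumSubcoreExact I r y J₀ c G) (hBc : NoCoincidenceExact I J₀ c G) : SliceGenericExact I y J₀ c G := by
  classical
  have hJr : J₀.card ≤ r := (card_le_card subset_union_left).trans hr
  refine sliceGenericExact_of_no_pairCore hI hT hS hB hJr hdisj fun K hK C t b _ _ hPC => ?_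
  have hKJ : K ⊆ J₀ := hK.trans (erase_subset c J₀)
  have hcK : c ∉ K := fun h => (mem_erase.1 (hK h)).1 rfl
  have hKr : K.card < r := lt_of_lt_of_le ((card_le_card hK).trans_lt (card_erase_lt_of_mem hcJ)) hJr
  have hdisjKG : Disjoint K G := hdisj.mono_left hKJ
  have hrKG : (K ∪ G).card ≤ r := (card_le_card (union_subset_union hKJ (Subset.refl _))).trans hr
  obtain ⟨K₀, F₁, F₂, d₁, d₂, hK₀, hF₁, hF₂, hcover, hne, hm₁, hlin, hslice, hD₂, hX, hread, hread₂, -, -, hflip, hterm, hempty⟩ :=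
    PairCore.normalForm hI hT hS hB hPC hKr hcK hdisjKG hrKG
  by_cases hK₀e : K₀ = ∅
  · -- branch (B): the raw empty-core coincidence
    subst hK₀e
    obtain ⟨hd₁, heven, hU, hrk₁, hrk₂⟩ := hempty rfl
    rw [sdiff_empty] at hF₁ hF₂ hcover hflip
    rw [hm₁] at hrk₁
    rw [hD₂.1] at hrk₂
    have hF₁ne : F₁.Nonempty := by
      rw [nonempty_iff_ne_empty]
      intro hF₁e
      have h := heven (I.vars c 0)
      rw [hF₁e, insert_empty, xpdeg_singleton_of_mem I hI ((mem_xpair I).2 (Or.inl rfl))] at h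
      exact absurd h (by decide)
    refine hBc K hK F₁ F₂ d₂.1 d₁.2.2 d₂.2.2 hF₁ hF₂ hcover hF₁ne heven (fun v hv => ?_) (fun z hz => ?_) (fun g hg => ?_) hrk₁ hrk₂
    · rcases hread₂ v hv with ⟨f, hf, -⟩ | ⟨g, hg, hgv⟩
      · exact absurd hf (notMem_empty f)
      · refine ⟨g, ?_, hgv⟩
        rw [hm₁, hD₂.1] at hg
        exact hg
    · refine hU z ⟨?_, ?_⟩
      · rw [hd₁, hm₁]; exact hz.1
      · rw [hD₂.1]; exact hz.2
    · obtain ⟨z, -, hz₁, hz₂⟩ := hflip g hg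
      refine ⟨z, ?_, ?_⟩
      · rw [hd₁, hm₁] at hz₁; exact hz₁
      · rw [hD₂.1] at hz₂; exact hz₂
  · -- branch (A), exact menu
    have hK₀ne : K₀.Nonempty := nonempty_iff_ne_empty.2 hK₀e
    exact hA K₀ (hK₀.trans hK) hK₀ne hX F₁ F₂ t d₁ d₂ (hF₁.trans (sdiff_subset_sdiff hK (Subset.refl _)))
      (hF₂.trans (sdiff_subset_sdiff hK (Subset.refl _))) hm₁ hD₂.1 hne hlin hread hread₂ hslice (hterm hK₀ne)

/-! ## Junk monomials poison coincidences -/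

/-- **POISON RULE FOR COINCIDENCES.**  Two readers, the first monomial-only with monomial set `F₁`, the second `(C₂, M)`; a monomial `g ∈ M` with
AND variables `σ, π` such that `π` lies in no monomial of `F₁` and in no other monomial of `M`, and `σ` lies in no monomial of `F₁`.  If the first
reader takes the value `β₁` somewhere, the two readers are jointly satisfiable at `(β₁, β₂)`: flip `π` (the second reader moves by
`x_σ ⊕ [π ∈ C₂]`), or first `σ` (the first reader does not move) and then `π`. -/
theorem exists_joint_of_junk (hI : I.IsPure xorAndPred) {F₁ M : Finset (Fin m)} {C₂ : Finset (Fin n)} {β₁ β₂ : Bool} {g : Fin m}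
    (hg : g ∈ M) {σ π : Fin n} (hslots : (I.vars g 2 = σ ∧ I.vars g 3 = π) ∨ (I.vars g 2 = π ∧ I.vars g 3 = σ))
    (hπ₁ : ∀ f ∈ F₁, I.vars f 2 ≠ π ∧ I.vars f 3 ≠ π) (hπM : ∀ g' ∈ M, g' ≠ g → I.vars g' 2 ≠ π ∧ I.vars g' 3 ≠ π)
    (hσ₁ : ∀ f ∈ F₁, I.vars f 2 ≠ σ ∧ I.vars f 3 ≠ σ) (hsat : ∃ z : Fin n → Bool, gval I ∅ F₁ z = β₁) :
    ∃ z : Fin n → Bool, gval I ∅ F₁ z = β₁ ∧ gval I C₂ M z = β₂ := by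
  classical
  obtain ⟨z, hz⟩ := hsat
  have hσπ : σ ≠ π := by
    have hpq : I.vars g 2 ≠ I.vars g 3 := fun e => absurd (hI.2 g e) (by decide)
    rcases hslots with ⟨h2, h3⟩ | ⟨h2, h3⟩
    · rw [← h2, ← h3]; exact hpq
    · rw [← h2, ← h3]; exact hpq.symm
  -- flipping `π` or `σ` keeps the first reader
  have keepπ : ∀ x : Fin n → Bool, gval I ∅ F₁ (Function.update x π (!x π)) = gval I ∅ F₁ x :=
    fun x => gval_update_of_forall_ne I x (notMem_empty π) hπ₁ _
  have keepσ : ∀ x : Fin n → Bool, gval I ∅ F₁ (Function.update x σ (!x σ)) = gval I ∅ F₁ x :=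
    fun x => gval_update_of_forall_ne I x (notMem_empty σ) hσ₁ _
  -- flipping `π` moves the second reader by `x_σ ⊕ [π ∈ C₂]`
  have moveπ : ∀ x : Fin n → Bool, gval I C₂ M (Function.update x π (!x π)) = xor (gval I C₂ M x) (xor (x σ) (decide (π ∈ C₂))) := by
    intro x
    rw [gval_flip_halfFree I hI C₂ M hslots hπM x, decide_eq_true hg, Bool.true_and]
  by_cases h0 : gval I C₂ M z = β₂
  · exact ⟨z, hz, h0⟩
  by_cases h1 : xor (z σ) (decide (π ∈ C₂)) = true
  · refine ⟨Function.update z π (!z π), by rw [keepπ, hz], ?_⟩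
    rw [moveπ, h1]
    revert h0; cases gval I C₂ M z <;> cases β₂ <;> decide
  · set z' := Function.update z σ (!z σ) with hz'
    have hz'₁ : gval I ∅ F₁ z' = β₁ := by rw [hz', keepσ, hz]
    by_cases h2 : gval I C₂ M z' = β₂
    · exact ⟨z', hz'₁, h2⟩
    · refine ⟨Function.update z' π (!z' π), by rw [keepπ, hz'₁], ?_⟩
      have hσ' : z' σ = !z σ := by rw [hz', Function.update_self]
      rw [moveπ, hσ']
      revert h1 h2; cases gval I C₂ M z' <;> cases β₂ <;> cases z σ <;> cases decide (π ∈ C₂) <;> decide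

/-- **A JUNK MONOMIAL KILLS AN EXACT COINCIDENCE**: in the data of `NoCoincidenceExact`, a monomial `g ∈ G ∪ F₂` whose variable `π` occurs in no
other monomial of `F₁ ∪ G ∪ F₂` and whose variable `σ` occurs in no monomial of `F₁` contradicts joint unsatisfiability (the first reader does take
its target value: the flip witness of `g`). -/
theorem false_of_coincidence_junk (hI : I.IsPure xorAndPred) {K F₁ F₂ G : Finset (Fin m)} {C₂ : Finset (Fin n)} {β₁ β₂ : Bool}
    (hU : ∀ z : Fin n → Bool, ¬ (gval I ∅ F₁ z = β₁ ∧ gval I C₂ (G ∪ F₂) z = β₂))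
    (hflip : ∀ g ∈ K ∪ G, ∃ z : Fin n → Bool, (gval I ∅ F₁ z = β₁ ↔ g ∉ F₁) ∧ (gval I C₂ (G ∪ F₂) z = β₂ ↔ g ∉ G ∪ F₂))
    {g : Fin m} (hg : g ∈ G ∪ F₂) (hgK : g ∈ K ∪ G) {σ π : Fin n} (hslots : (I.vars g 2 = σ ∧ I.vars g 3 = π) ∨ (I.vars g 2 = π ∧ I.vars g 3 = σ))
    (hπ₁ : ∀ f ∈ F₁, I.vars f 2 ≠ π ∧ I.vars f 3 ≠ π) (hπM : ∀ g' ∈ G ∪ F₂, g' ≠ g → I.vars g' 2 ≠ π ∧ I.vars g' 3 ≠ π)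
    (hσ₁ : ∀ f ∈ F₁, I.vars f 2 ≠ σ ∧ I.vars f 3 ≠ σ) : False := by
  -- `g ∉ F₁`: a member of `F₁ ⊆ K` lying in `G ∪ F₂` with `π` in no monomial of `F₁` is impossible
  have hgF₁ : g ∉ F₁ := by
    intro hgF
    rcases hslots with ⟨-, h3⟩ | ⟨h2, -⟩
    · exact (hπ₁ g hgF).2 h3
    · exact (hπ₁ g hgF).1 h2
  obtain ⟨z, hz₁, -⟩ := hflip g hgK
  obtain ⟨z', hz'₁, hz'₂⟩ := exists_joint_of_junk hI hg hslots hπ₁ hπM hσ₁ ⟨z, hz₁.2 hgF₁⟩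
  exact hU z' ⟨hz'₁, hz'₂⟩

/-! ## The sharp joint node and the core bound from it -/

/-- **`SharpMenuCriterionBound` (OPEN, census-type, JOINT IN THE MENU, SEMANTIC (B))**: as `PstarMenuCriterion.MenuCriterionBound` with the exact
coincidence node `NoCoincidenceExact c G` in place of the combinatorial `NoShortCoincidence c G`.  FRONTIER. -/
@[conjecture] def SharpMenuCriterionBound : Prop :=
  ∀ (n m r : ℕ) (I : LocalMap 4 n m), I.IsPure xorAndPred → Typed I → SimpleOverlap I → BoundaryExpanding r I →
    ∀ (y : Fin m → Bool) (J₀ : Finset (Fin m)) (w₁ w₂ : Finset (Fin n) × Finset (Fin m) × Bool), Terminal I r y J₀ w₁ w₂ →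
      (∃ S ⊆ J₀, S.Nonempty ∧ (∀ w ∈ xverts I S, 2 ≤ xpdeg I S w) ∧ ∀ f ∈ S, ¬ IsChord I J₀ f) →
      Covered I J₀ (w₁.2.1 ∪ w₂.2.1) → Anchored I J₀ (w₁.2.1 ∪ w₂.2.1) → NoTwoCrossings I J₀ (w₁.2.1 ∪ w₂.2.1) →
      ∃ ℬ ⊆ J₀, ℬ.card + 2 ≤ (sharedSlots I J₀).card ∧
        ∀ c ∈ J₀, c ∉ ℬ → IsChord I J₀ c → OutsideGated I J₀ (w₁.2.1 ∪ w₂.2.1) c → SkConnected I J₀ (w₁.2.1 ∪ w₂.2.1) c →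
          ∀ G ∈ channelMenus I J₀ w₁ w₂, NoSmallPathSumSubcoreExact I r y J₀ c G ∧ NoCoincidenceExact I J₀ c G

/-- The sharp node is weaker than the combinatorial one. -/
theorem sharpMenuCriterionBound_of_menuCriterionBound (h : PstarMenuCriterion.MenuCriterionBound) : SharpMenuCriterionBound := by
  intro n m r I hI hT hS hB y J₀ w₁ w₂ ht hS₀ hcov hanc hN2
  obtain ⟨ℬ, hℬJ, hℬ, hgood⟩ := h n m r I hI hT hS hB y J₀ w₁ w₂ ht hS₀ hcov hanc hN2
  have hdisj : Disjoint J₀ (w₁.2.1 ∪ w₂.2.1) := disjoint_union_right.2 ⟨ht.2.2.2.1, ht.2.2.2.2.1⟩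
  refine ⟨ℬ, hℬJ, hℬ, fun c hc hcℬ hch hO hsk G hG => ?_⟩
  obtain ⟨hA, hBc⟩ := hgood c hc hcℬ hch hO hsk G hG
  exact ⟨hA, noCoincidenceExact_of_noShortCoincidence hI hS
    (hdisj.mono_right ((subset_of_mem_channelMenus hG).trans (internalMenu_subset I J₀ _))) hBc⟩

variable {w₁ w₂ : Finset (Fin n) × Finset (Fin m) × Bool}

/-- **Exact genericity for the four menus from the sharp per-menu criterion** (under the induction hypothesis on sub-cores). -/
theorem menuGeneric_of_criterionSharp (hI : I.IsPure xorAndPred) (hT : Typed I) (hS : SimpleOverlap I) (hB : BoundaryExpanding r I)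
    (ht : Terminal I r y J₀ w₁ w₂) (hc : c ∈ J₀)
    (hIH : ∀ K₀ ⊆ J₀.erase c, ∀ d₁ d₂ : Finset (Fin n) × Finset (Fin m) × Bool, Terminal I r y K₀ d₁ d₂ → K₀.card ≤ 5)
    (h : ∀ G ∈ channelMenus I J₀ w₁ w₂, NoSmallPathSumSubcoreExact I r y J₀ c G ∧ NoCoincidenceExact I J₀ c G) :
    MenuGeneric I y J₀ c w₁ w₂ := by
  have hdisj : Disjoint J₀ (w₁.2.1 ∪ w₂.2.1) := disjoint_union_right.2 ⟨ht.2.2.2.1, ht.2.2.2.2.1⟩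
  have hr : (J₀ ∪ (w₁.2.1 ∪ w₂.2.1)).card ≤ r := by rw [← union_assoc]; exact ht.2.2.2.2.2.1
  have gen : ∀ G ∈ channelMenus I J₀ w₁ w₂, SliceGenericExact I y J₀ c G := by
    intro G hG
    have hGsub : G ⊆ w₁.2.1 ∪ w₂.2.1 := (subset_of_mem_channelMenus hG).trans (internalMenu_subset I J₀ _)
    obtain ⟨hA, hBc⟩ := h G hG
    exact sliceGenericExact_of_criterionSharp hI hT hS hB hc (hdisj.mono_right hGsub)
      ((card_le_card (union_subset_union (Subset.refl _) hGsub)).trans hr) (noPathSumSubcoreExact_of_small hIH hA) hBc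
  unfold PstarMenuCriterion.channelMenus at gen
  exact ⟨gen _ (by simp), gen _ (by simp), gen _ (by simp), gen _ (by simp)⟩

/-- **THE CORE BOUND FROM O2 AND THE SHARP JOINT MENU CRITERION BOUND** — strong induction on `#J₀`. -/
theorem terminalFive_of_sharpMenuBound (hO2 : TerminalFiveA) (hb : SharpMenuCriterionBound) : TerminalFive := by
  classical
  suffices H : ∀ (k n m r : ℕ) (I : LocalMap 4 n m), I.IsPure xorAndPred → Typed I → SimpleOverlap I → BoundaryExpanding r I →
      ∀ (y : Fin m → Bool) (J₀ : Finset (Fin m)) (w₁ w₂ : Finset (Fin n) × Finset (Fin m) × Bool), Terminal I r y J₀ w₁ w₂ →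
        J₀.card = k → J₀.card ≤ 5 from
    fun n m r I hI hT hS hB y J₀ w₁ w₂ ht => H _ n m r I hI hT hS hB y J₀ w₁ w₂ ht rfl
  intro k
  induction k using Nat.strong_induction_on with
  | _ k ih =>
    intro n m r I hI hT hS hB y J₀ w₁ w₂ ht hk
    by_cases hP : PstarChordBridgeCotree.Peelable I (nonchords I J₀)
    · obtain ⟨F, hS₀F, hFJ, hPF, hmax⟩ := exists_maximal_peelable_sup I (nonchords_subset I J₀) hP
      refine hO2 n m r I hI hT hS hB y J₀ w₁ w₂ ht F hFJ hPF hmax fun e he => ?_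
      rw [mem_sdiff] at he
      by_contra hc
      exact he.2 (hS₀F ((mem_nonchords I).2 ⟨he.1, hc⟩))
    · exfalso
      obtain ⟨S, hSJ, hne, hL, hnc⟩ := exists_centre_of_not_peelable I hP
      have hdisj : Disjoint J₀ (w₁.2.1 ∪ w₂.2.1) := disjoint_union_right.2 ⟨ht.2.2.2.1, ht.2.2.2.2.1⟩
      set 𝒢 := w₁.2.1 ∪ w₂.2.1 with h𝒢
      have hIH : ∀ c ∈ J₀, ∀ K₀ ⊆ J₀.erase c, ∀ d₁ d₂ : Finset (Fin n) × Finset (Fin m) × Bool, Terminal I r y K₀ d₁ d₂ → K₀.card ≤ 5 := by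
        intro c hc K₀ hK₀ d₁ d₂ ht₀
        have hlt : K₀.card < k := by
          rw [← hk]
          exact lt_of_le_of_lt (card_le_card hK₀) (card_erase_lt_of_mem hc)
        exact ih K₀.card hlt n m r I hI hT hS hB y K₀ d₁ d₂ ht₀ rfl
      have hN2 : NoTwoCrossings I J₀ 𝒢 := fun W e₁ e₂ he₁ he₂ hne hc₁ hc₂ hcut =>
        false_of_cleanCut_two hI hT hS hB ht hIH hcut he₁ he₂ hne hc₁ hc₂
      obtain ⟨ℬ, -, hℬ, hgood⟩ := hb n m r I hI hT hS hB y J₀ w₁ w₂ ht ⟨S, hSJ, hne, hL, hnc⟩ (covered_of_terminal hI hT hS hB ht)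
        (anchored_of_terminal hI hT hS hB ht) hN2
      obtain ⟨𝒞, h𝒞J, hch, hO, hcard⟩ := exists_clean_chords hB ht
      have hU : 1 < (𝒞 \ ℬ).card := by
        have := le_card_sdiff ℬ 𝒞
        omega
      obtain ⟨a, ha, b, hb', hab⟩ := one_lt_card.1 hU
      obtain ⟨ha𝒞, haℬ⟩ := mem_sdiff.1 ha
      obtain ⟨hb𝒞, hbℬ⟩ := mem_sdiff.1 hb'
      have hcrit : ∀ c ∈ 𝒞, c ∉ ℬ → ∀ G ∈ channelMenus I J₀ w₁ w₂,
          NoSmallPathSumSubcoreExact I r y J₀ c G ∧ NoCoincidenceExact I J₀ c G := by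
        intro c hc hcℬ G hG
        by_cases hsk : SkConnected I J₀ 𝒢 c
        · exact hgood c (h𝒞J hc) hcℬ (hch c hc) (hO c hc) hsk G hG
        · unfold PstarCleanCutAssembly.SkConnected at hsk
          push Not at hsk
          obtain ⟨W, hcW, hcut⟩ := hsk
          obtain ⟨hA, hBc⟩ := smallCriterion_of_crossing (y := y) (r := r) hI hT hS hB hdisj (fun f hf hcf => hcut f hf hcf) hcW
          have hGsub := subset_of_mem_channelMenus hG
          exact ⟨noSmallPathSumSubcoreExact_of_subset hA hGsub,
            noCoincidenceExact_of_noShortCoincidence hI hS (hdisj.mono_right (hGsub.trans (internalMenu_subset I J₀ _)))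
              (PstarMenuCriterion.noShortCoincidence_anti hBc hGsub)⟩
      have hgen : ∀ c ∈ 𝒞, c ∉ ℬ → MenuGeneric I y J₀ c w₁ w₂ := fun c hc hcℬ =>
        menuGeneric_of_criterionSharp hI hT hS hB ht (h𝒞J hc) (hIH c (h𝒞J hc)) (hcrit c hc hcℬ)
      exact false_of_two_clean_exact hI hT hS hB ht (h𝒞J ha𝒞) (h𝒞J hb𝒞) hab (hch a ha𝒞) (hch b hb𝒞) (hO a ha𝒞) (hO b hb𝒞)
        (hgen a ha𝒞 haℬ) (hgen b hb𝒞 hbℬ)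

/-- **O1 from the same inputs.** -/
theorem terminalPeelable_of_sharpMenuBound (hO2 : TerminalFiveA) (hb : SharpMenuCriterionBound) : TerminalPeelable :=
  terminalPeelable_of_terminalFive (terminalFive_of_sharpMenuBound hO2 hb)

end Summit.PneNP.PneNP.Theorems.PstarCoincidenceExact
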